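import Summits.QuantumFields.YangMills.Theorems.AlphaInputsT3ACv3StepTrivPinsChart
import Summits.QuantumFields.YangMills.Theorems.AlphaInputsT3ACWeightedFibreFormula
import HarnessLib

/-!
# `AlphaInputsT3ACv3StepTrivPinsChartLocal` — BOTH trivial-history fibre rows of `…AlphaInputsT3ACv3StepTrivPinsChart` with a LOCAL chart hypothesis:
# `hchart` asked only for densities supported in a displayed region `O` of fine fields (cell ym3-torus; desk pub/ym-inputs INPUT-LIST v8 §3 I-10 ∕ I-12,
# memos `I10-B2-FIBRE-LOCATE-p08.md`, `B2F2-CHART-LOCATE-p08g3.md`; seat ym-inputs-p08 g3; helper `--supports stmt-QuantumFields-20520`)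

WHY.  The averaging-agnostic rows `PinnedStepTrivPins.fibre55WinAC_triv_of_chart` ∕ `fibre57LowOnAC_of_chart` display ONE hypothesis `hchart` — a weighted
fibre chart identity `(T_kρ)(V) = e^{(ℓσ + d_g·log g_k)·N}·∫ J(V,ω)·ρ(Φ(V,ω)) dvol(ω)` for ALL bounded measurable gauge-invariant `ρ`.  Each row USES it exactly
once: the upper row at `ρ = χB_k(triv′)·e^{−mainT_k + 𝒫_k + c}` (supported where `χB_k(triv′) ≠ 0`), the lower row at `ρ = 𝟙_{lo k}·e^{…}` (supported in
`lo k`).  The chart the tree can supply for the T³ record's averaging `blockAvg ℰp` — the private-coordinate chart of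
`…AlphaInputsT3ACBlockAvgEMLWeightedFibreChart.exists_chart_rnTransport_ae_eq` (and likewise print's (13)+(17)+(18), solvable only for small fields) —
is LOCAL: valid for densities supported in the small-loop region `O_ε`.  THIS FILE re-runs both rows verbatim with `hchart` weakened to
`∀ ρ …, (∀ U ∉ O, ρ U = 0) → …` for a displayed `O` with `{χB_k(triv′) ≠ 0} ⊆ O` (`hO`, BOTH rows — in the lower row the chart is applied to
the `χB`-cut integrand and compared to the `𝟙_{lo k}`-cut one by the a.e. monotonicity of the transport, `Transport48.rnTransport_mono_ae`, which also
removes the global form's `hΦm`∕`hJi`; located by ★w6-19936 g4): `fibre55WinAC_triv_of_localChart`, `fibre57LowOnAC_of_localChart`.  It also records the currency exchange from the socket of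
`…AlphaInputsT3ACWeightedFibreFormula` (local form, parameter space `(R, κ)`, weight `𝟙_S·J`) to the rows' `hchart` shape with print's normalisation
prefactor (`localChart_of_hmap`: take `J′ := e^{−(ℓσ + d_g log g_k)N}·𝟙_S·J`).  For `blockAvg ℰp` the window inclusion `{χB_k(triv′) ≠ 0} ⊆ O_ε` is the
plaquette-to-loop bound `LatticeWordStokes.dist1_loopHol_le` at `((d+2)L)²ε₁/4 < ε` (not restated here).

HONEST SCOPE.  [folklore] bookkeeping; the rows are proved MODULO the local `hchart`, the pins and the displayed rows — NO (O″χ) row is discharged at free data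
(RULING g26-№2); count-neutral; no summit ∕ sub-problem statement proved (rung R3 bookkeeping; not T⁴, not Clay; the Yang–Mills mass gap is NOT proved).
Def-free; L-floor: none.  References: T. Bałaban, CMP 102 (1985) 255–275 [Balaban1985UV3] ((13)–(22) pp.259–261, (37) p.265, (47)–(51) pp.267–268, (53)–(58)
pp.269–270, p.272 L32–33); CMP 98 (1985) 17–51 [Balaban1985Averaging] ((10) p.19).
-/

set_option autoImplicit false

noncomputable section

namespace Summit.QuantumFields.YangMills.Theorems.PinnedStepTrivPins

open MeasureTheory Literature.MathematicalPhysics.QuantumFieldTheory.Balaban1983to89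
open Literature.MathematicalPhysics.QuantumFieldTheory.Balaban1983to89.AveragingRT (rnTransport)
open Literature.MathematicalPhysics.QuantumFieldTheory.Balaban1983to89.GaugeField (GaugeInvariant gaugeAct)
open Literature.MathematicalPhysics.QuantumFieldTheory.Balaban1985CMP102 Literature.MathematicalPhysics.QuantumFieldTheory.Balaban1985CMP102.Setting
open Summit.QuantumFields.Balaban3D.Carriers
open Summit.QuantumFields.Balaban3D.Proofs.Inputs (LaneConsts)
open Summit.QuantumFields.Balaban3D.Proofs.ScalesArithmetic (gk_pos)
open Summit.QuantumFields.Balaban3D.Proofs.TowerAC Summit.QuantumFields.Balaban3D.Proofs.StandardAC Summit.QuantumFields.Balaban3D.Proofs.InputsAC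
open Summit.QuantumFields.Balaban3D.Proofs.Bound55Masses (chiB chiB_nonneg chiB_le_one measurable_chiB)
open Summit.QuantumFields.Balaban3D.Proofs.GaussianNormalization (partZ normalized integral_exp_neg_mul_eq)
open Summit.QuantumFields.Balaban3D.Proofs (Bound55Std.measurable_actionEta)
open Summit.QuantumFields.YangMills.Theorems.PinnedStep (massP wtP Fibre55WinAC Fibre57LowOnAC)

variable {L : ℕ} (𝔎 : LaneConsts L) {S : Scales L} {G : Type} [GaugeGroup G] [MeasurableSpace G] [HaarData G] [RegularGaugeGroup G]
  {Val : Type} [NormedAddCommGroup Val] [NormedSpace ℂ Val]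
  (X : ExternalInputsAC S G) (𝔖 : ∀ k, StepSeries S G Val (nblkOf S 𝔎.carrier k) k)

section Chart

variable {Ω : Type} [MeasurableSpace Ω]

/-- **THE UPPER ROW `Fibre55WinAC` AT THE TRIVIAL NEW HISTORY, EVERY LEVEL, ANY GAUGE GROUP, ANY AVERAGING WITH A LOCAL WEIGHTED FIBRE CHART**:
verbatim `fibre55WinAC_triv_of_chart` except that the chart identity `hchart` is asked only for densities VANISHING OFF a displayed region `O` of
level-`k` fields containing the support of `χB_k(triv′)` (`hO`) — the shape (B2-F2) supplies for `blockAvg ℰp` on the small-loop region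
(`…BlockAvgEMLWeightedFibreChart.exists_chart_rnTransport_ae_eq`; print's (17) is likewise solvable only for small fields).
[cite: Balaban1985UV3, (13)–(18) pp.259–260 + (49)–(55) pp.268–269 + (58) p.270] -/
theorem fibre55WinAC_triv_of_localChart (win : (k : ℕ) → Hist S.P (k + 1) → Set (GaugeField S.P (k + 1) G)) (k : ℕ) (hk : k + 1 ≤ S.P.m + S.P.K)
    (vol : Measure Ω) (Φ : GaugeField S.P (k + 1) G × Ω → GaugeField S.P k G) (J : GaugeField S.P (k + 1) G × Ω → ℝ) (hJ0 : ∀ z, 0 ≤ J z)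
    (hfibΦ : ∀ V ω, (X.av k).avg (Φ (V, ω)) = V) (N lσ dg : ℝ) (O : Set (GaugeField S.P k G))
    (hO : ∀ U : GaugeField S.P k G,
      chiB 𝔎.carrier.M₁ (rcolOf S 𝔎.carrier) (eps1Of S 𝔎.carrier) k (Hist.triv S.P (k + 1)) U ≠ 0 → U ∈ O)
    (hchart : ∀ (ρ : Density S.P k G) (C : ℝ), Measurable ρ → (∀ U, |ρ U| ≤ C) → GaugeInvariant ρ → (∀ U, U ∉ O → ρ U = 0) →
      rnTransport (X.av k).avg ρ =ᵐ[fieldMeasure S.P (k + 1) G] fun V =>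
        Real.exp ((lσ + dg * Real.log (S.gk k)) * N) * ∫ ω, J (V, ω) * ρ (Φ (V, ω)) ∂vol)
    (q : GaugeField S.P (k + 1) G → Ω → ℝ) (hqm : ∀ V, Measurable (q V)) (hZ : ∀ V, 0 < partZ vol (q V))
    (hU : Measurable (X.UkH k (Hist.triv S.P k))) (hPm : Measurable ((inputOfAC 𝔎 X 𝔖).Pint k (Hist.triv S.P k)))
    (cP : ℝ) (hPb : ∀ U, (inputOfAC 𝔎 X 𝔖).Pint k (Hist.triv S.P k) U ≤ cP)
    (hinv : GaugeInvariant (fun U : GaugeField S.P k G =>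
      Real.exp (-((towerOfAC 𝔎 X 𝔖).mainT k (Hist.triv S.P k) U) + (towerOfAC 𝔎 X 𝔖).Pint k (Hist.triv S.P k) U)))
    (hwt : ∀ U : GaugeField S.P k G,
      chiB 𝔎.carrier.M₁ (rcolOf S 𝔎.carrier) (eps1Of S 𝔎.carrier) k (Hist.triv S.P (k + 1)) U ≠ 0 → wtP 𝔎 X win k (Hist.triv S.P k) U = 1)
    (hsmall : ∀ U : GaugeField S.P k G,
      chiB 𝔎.carrier.M₁ (rcolOf S 𝔎.carrier) (eps1Of S 𝔎.carrier) k (Hist.triv S.P (k + 1)) U ≠ 0 → (X.av k).avg U ∈ win k (Hist.triv S.P (k + 1)))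
    (hσ : (piecesAC 𝔎 X 𝔖 k).logσ₀ = lσ) (hdg : (piecesAC 𝔎 X 𝔖 k).dg = dg) (hstar : (piecesAC 𝔎 X 𝔖 k).starB (Hist.triv S.P (k + 1)) = N)
    (hZU : ∀ V, (piecesAC 𝔎 X 𝔖 k).logZU (Hist.triv S.P (k + 1)) V = Real.log (partZ vol (q V)))
    (hFl : ∀ V, (piecesAC 𝔎 X 𝔖 k).logFl (Hist.triv S.P (k + 1)) V =
      Real.log (∫ ω, J (V, ω) * chiB 𝔎.carrier.M₁ (rcolOf S 𝔎.carrier) (eps1Of S 𝔎.carrier) k (Hist.triv S.P (k + 1)) (Φ (V, ω)) *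
              Real.exp (-((towerOfAC 𝔎 X 𝔖).mainT k (Hist.triv S.P k) (Φ (V, ω)) - (towerOfAC 𝔎 X 𝔖).mainT (k + 1) (Hist.triv S.P (k + 1)) V)
                + ((towerOfAC 𝔎 X 𝔖).Pint k (Hist.triv S.P k) (Φ (V, ω)) - (piecesAC 𝔎 X 𝔖 k).Pold (Hist.triv S.P (k + 1)) V) + q V ω)
            ∂(normalized vol (q V)))) :
    Fibre55WinAC 𝔎 X 𝔖 win k (Hist.triv S.P (k + 1)) := by
  classical
  set χ₀ : GaugeField S.P k G → ℝ := chiB 𝔎.carrier.M₁ (rcolOf S 𝔎.carrier) (eps1Of S 𝔎.carrier) k (Hist.triv S.P (k + 1)) with hχ₀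
  set c : ℝ := -(towerOfAC 𝔎 X 𝔖).Ecst k + (towerOfAC 𝔎 X 𝔖).Zterm k (Hist.triv S.P k) + (towerOfAC 𝔎 X 𝔖).Rm k with hc
  set ρ : Density S.P k G := fun U => χ₀ U *
    Real.exp (-((towerOfAC 𝔎 X 𝔖).mainT k (Hist.triv S.P k) U) + (towerOfAC 𝔎 X 𝔖).Pint k (Hist.triv S.P k) U + c) with hρ
  have hχm : Measurable χ₀ := measurable_chiB _ _ _ k _
  have hχinv : GaugeInvariant χ₀ := fun u U => chiB_gaugeAct _ _ _ k _ u U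
  obtain ⟨hρm, hρb, hρinv⟩ := trivIntegrand_props 𝔎 X 𝔖 k hU hPm cP hPb hinv χ₀ hχm (fun U => chiB_nonneg _ _ _ k _ U)
    (fun U => chiB_le_one _ _ _ k _ U) hχinv c
  -- the row's integrand at `triv′` IS `ρ`
  have hint : (fun U => stepWeight 𝔎.carrier.M₁ (rcolOf S 𝔎.carrier) (eps1Of S 𝔎.carrier) (epsSOf S 𝔎.carrier) k (Hist.triv S.P (k + 1)) U *
        chiB 𝔎.carrier.M₁ (rcolOf S 𝔎.carrier) (eps1Of S 𝔎.carrier) k (Hist.triv S.P (k + 1)) U *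
        (wtP 𝔎 X win k (Hist.triv S.P (k + 1)).proj U *
          Real.exp (-((towerOfAC 𝔎 X 𝔖).mainT k (Hist.triv S.P (k + 1)).proj U) + (towerOfAC 𝔎 X 𝔖).Pint k (Hist.triv S.P (k + 1)).proj U
            - (towerOfAC 𝔎 X 𝔖).Ecst k + (towerOfAC 𝔎 X 𝔖).Zterm k (Hist.triv S.P (k + 1)).proj + (towerOfAC 𝔎 X 𝔖).Rm k))) = ρ := by
    funext U
    rw [stepWeight_triv 𝔎.carrier.M₁ (rcolOf S 𝔎.carrier) (eps1Of S 𝔎.carrier) (epsSOf S 𝔎.carrier) (by omega) U, one_mul, Hist.proj_triv, hρ]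
    dsimp only
    by_cases h0 : chiB 𝔎.carrier.M₁ (rcolOf S 𝔎.carrier) (eps1Of S 𝔎.carrier) k (Hist.triv S.P (k + 1)) U = 0
    · have h0' : χ₀ U = 0 := h0
      rw [h0, h0', zero_mul, zero_mul]
    · rw [hwt U h0, one_mul]; congr 2; rw [hc]; ring
  -- `ρ` vanishes off `O` (it carries the factor `χB_k(triv′)`)
  have hρO : ∀ U, U ∉ O → ρ U = 0 := fun U hU => by
    have h0 : χ₀ U = 0 := by
      by_contra h
      exact hU (hO U h)
    rw [hρ]; dsimp only; rw [h0, zero_mul]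
  have hT := hchart ρ _ hρm hρb hρinv hρO
  have hg : 0 < S.gk k := gk_pos S k
  have hgk : (towerOfAC 𝔎 X 𝔖).g k = S.gk k := rfl
  have hproj : (piecesAC 𝔎 X 𝔖 k).proj (Hist.triv S.P (k + 1)) = Hist.triv S.P k := (piecesAC 𝔎 X 𝔖 k).proj_triv
  unfold Fibre55WinAC
  rw [hint]
  refine hT.trans_le ?_
  filter_upwards with V
  set m₁ : ℝ := (towerOfAC 𝔎 X 𝔖).mainT (k + 1) (Hist.triv S.P (k + 1)) V with hm₁
  set Po : ℝ := (piecesAC 𝔎 X 𝔖 k).Pold (Hist.triv S.P (k + 1)) V with hPo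
  by_cases hV : V ∈ win k (Hist.triv S.P (k + 1))
  · rw [Set.indicator_of_mem hV, one_mul, massP_triv 𝔎 X (k + 1) V, one_mul, hσ, hdg, hgk, hstar, hZU V, hproj, hFl V]
    -- the transported integrand as `Z_q(V)` times the normalised integral of `Ψ·e^{−m₁ + Po + c}`
    have hΨ : ∀ ω, J (V, ω) * ρ (Φ (V, ω)) = Real.exp (-(q V ω)) * (Real.exp (-m₁ + Po + c) *
        (J (V, ω) * χ₀ (Φ (V, ω)) * Real.exp (-((towerOfAC 𝔎 X 𝔖).mainT k (Hist.triv S.P k) (Φ (V, ω)) - m₁)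
          + ((towerOfAC 𝔎 X 𝔖).Pint k (Hist.triv S.P k) (Φ (V, ω)) - Po) + q V ω))) := fun ω => by
      rw [hρ]; dsimp only
      have e : Real.exp (-((towerOfAC 𝔎 X 𝔖).mainT k (Hist.triv S.P k) (Φ (V, ω))) + (towerOfAC 𝔎 X 𝔖).Pint k (Hist.triv S.P k) (Φ (V, ω)) + c)
          = Real.exp (-(q V ω)) * (Real.exp (-m₁ + Po + c) * Real.exp (-((towerOfAC 𝔎 X 𝔖).mainT k (Hist.triv S.P k) (Φ (V, ω)) - m₁)
            + ((towerOfAC 𝔎 X 𝔖).Pint k (Hist.triv S.P k) (Φ (V, ω)) - Po) + q V ω)) := by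
        rw [← Real.exp_add, ← Real.exp_add]; congr 1; ring
      rw [e]; ring
    simp_rw [hΨ]
    rw [integral_exp_neg_mul_eq (hqm V) (hZ V), integral_const_mul]
    have hI0 : 0 ≤ ∫ ω, J (V, ω) * χ₀ (Φ (V, ω)) * Real.exp (-((towerOfAC 𝔎 X 𝔖).mainT k (Hist.triv S.P k) (Φ (V, ω)) - m₁)
          + ((towerOfAC 𝔎 X 𝔖).Pint k (Hist.triv S.P k) (Φ (V, ω)) - Po) + q V ω) ∂(normalized vol (q V)) :=
      integral_nonneg fun ω => mul_nonneg (mul_nonneg (hJ0 _) (chiB_nonneg _ _ _ k _ _)) (Real.exp_pos _).le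
    refine le_trans (le_of_eq ?_) ((exp_mul_le_exp_log_gen (-m₁ - (towerOfAC 𝔎 X 𝔖).Ecst k + Po + (towerOfAC 𝔎 X 𝔖).Zterm k (Hist.triv S.P k)
      + (towerOfAC 𝔎 X 𝔖).Rm k) ((lσ + dg * Real.log (S.gk k)) * N) _ _ (hZ V) hI0).trans_eq ?_)
    · have e : Real.exp (-m₁ + Po + c) = Real.exp (-m₁ - (towerOfAC 𝔎 X 𝔖).Ecst k + Po + (towerOfAC 𝔎 X 𝔖).Zterm k (Hist.triv S.P k)
          + (towerOfAC 𝔎 X 𝔖).Rm k) := by congr 1; rw [hc]; ring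
      rw [e]; ring
    · congr 1; ring
  · rw [Set.indicator_of_notMem hV, zero_mul, zero_mul]
    have hzero : (fun ω => J (V, ω) * ρ (Φ (V, ω))) = fun _ => 0 := by
      funext ω
      have hχ : χ₀ (Φ (V, ω)) = 0 := by
        by_contra h
        exact hV (by simpa only [hfibΦ V ω] using hsmall _ h)
      rw [hρ]; dsimp only; rw [hχ, zero_mul, mul_zero]
    rw [hzero, integral_zero, mul_zero]

/-- **THE LOWER ROW `Fibre57LowOnAC` AT EVERY LEVEL, ANY GAUGE GROUP, ANY AVERAGING WITH A LOCAL WEIGHTED FIBRE CHART**: as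
`fibre57LowOnAC_of_chart`, but the chart identity is applied to the `χB`-CUT integrand only (supported in `{χB_k(triv′) ≠ 0} ⊆ O`, displayed `hO` —
the SAME region as the upper row; NO `lo k ⊆ O` is needed) and the comparison `T[χB·e^{…}] ≤ T[𝟙_{lo k}·e^{…}]` is the a.e. MONOTONICITY of the
transport (`Transport48.rnTransport_mono_ae`, `χB ≤ 𝟙_{lo k}` by `hdom`) instead of a pointwise comparison on the fibre — so the binders `hΦm`∕`hJi`
of the global form also disappear (located by ★w6-19936 g4, ym3-torus 11:15:10Z (4)). [cite: Balaban1985UV3, (37) p.265 + (47) p.267 + (55)–(58) pp.269–270 + p.272 L32–33] -/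
theorem fibre57LowOnAC_of_localChart (lo : (k : ℕ) → Set (GaugeField S.P k G)) (k : ℕ)
    (vol : Measure Ω) (Φ : GaugeField S.P (k + 1) G × Ω → GaugeField S.P k G) (J : GaugeField S.P (k + 1) G × Ω → ℝ) (hJ0 : ∀ z, 0 ≤ J z)
    (N lσ dg : ℝ) (O : Set (GaugeField S.P k G))
    (hO : ∀ U : GaugeField S.P k G,
      chiB 𝔎.carrier.M₁ (rcolOf S 𝔎.carrier) (eps1Of S 𝔎.carrier) k (Hist.triv S.P (k + 1)) U ≠ 0 → U ∈ O)
    (hchart : ∀ (ρ : Density S.P k G) (C : ℝ), Measurable ρ → (∀ U, |ρ U| ≤ C) → GaugeInvariant ρ → (∀ U, U ∉ O → ρ U = 0) →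
      rnTransport (X.av k).avg ρ =ᵐ[fieldMeasure S.P (k + 1) G] fun V =>
        Real.exp ((lσ + dg * Real.log (S.gk k)) * N) * ∫ ω, J (V, ω) * ρ (Φ (V, ω)) ∂vol)
    (q : GaugeField S.P (k + 1) G → Ω → ℝ) (hqm : ∀ V, Measurable (q V)) (hZ : ∀ V, 0 < partZ vol (q V))
    (hU : Measurable (X.UkH k (Hist.triv S.P k))) (hPm : Measurable ((inputOfAC 𝔎 X 𝔖).Pint k (Hist.triv S.P k)))
    (cP : ℝ) (hPb : ∀ U, (inputOfAC 𝔎 X 𝔖).Pint k (Hist.triv S.P k) U ≤ cP)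
    (hinv : GaugeInvariant (fun U : GaugeField S.P k G =>
      Real.exp (-((towerOfAC 𝔎 X 𝔖).mainT k (Hist.triv S.P k) U) + (towerOfAC 𝔎 X 𝔖).Pint k (Hist.triv S.P k) U)))
    (hlom : MeasurableSet (lo k)) (hloinv : ∀ (u : GaugeTransf S.P k G) (U : GaugeField S.P k G), gaugeAct u U ∈ lo k ↔ U ∈ lo k)
    (hdom : ∀ U : GaugeField S.P k G,
      chiB 𝔎.carrier.M₁ (rcolOf S 𝔎.carrier) (eps1Of S 𝔎.carrier) k (Hist.triv S.P (k + 1)) U ≠ 0 → U ∈ lo k)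
    (hσ : (piecesAC 𝔎 X 𝔖 k).logσ₀ = lσ) (hdg : (piecesAC 𝔎 X 𝔖 k).dg = dg) (hstar : (piecesAC 𝔎 X 𝔖 k).starB (Hist.triv S.P (k + 1)) = N)
    (hZU : ∀ V, (piecesAC 𝔎 X 𝔖 k).logZU (Hist.triv S.P (k + 1)) V = Real.log (partZ vol (q V)))
    (hFl : ∀ V, (piecesAC 𝔎 X 𝔖 k).logFl (Hist.triv S.P (k + 1)) V =
      Real.log (∫ ω, J (V, ω) * chiB 𝔎.carrier.M₁ (rcolOf S 𝔎.carrier) (eps1Of S 𝔎.carrier) k (Hist.triv S.P (k + 1)) (Φ (V, ω)) *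
              Real.exp (-((towerOfAC 𝔎 X 𝔖).mainT k (Hist.triv S.P k) (Φ (V, ω)) - (towerOfAC 𝔎 X 𝔖).mainT (k + 1) (Hist.triv S.P (k + 1)) V)
                + ((towerOfAC 𝔎 X 𝔖).Pint k (Hist.triv S.P k) (Φ (V, ω)) - (piecesAC 𝔎 X 𝔖 k).Pold (Hist.triv S.P (k + 1)) V) + q V ω)
            ∂(normalized vol (q V))))
    (hpos : ∀ V, V ∈ lo (k + 1) →
      0 < ∫ ω, J (V, ω) * chiB 𝔎.carrier.M₁ (rcolOf S 𝔎.carrier) (eps1Of S 𝔎.carrier) k (Hist.triv S.P (k + 1)) (Φ (V, ω)) *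
              Real.exp (-((towerOfAC 𝔎 X 𝔖).mainT k (Hist.triv S.P k) (Φ (V, ω)) - (towerOfAC 𝔎 X 𝔖).mainT (k + 1) (Hist.triv S.P (k + 1)) V)
                + ((towerOfAC 𝔎 X 𝔖).Pint k (Hist.triv S.P k) (Φ (V, ω)) - (piecesAC 𝔎 X 𝔖 k).Pold (Hist.triv S.P (k + 1)) V) + q V ω)
            ∂(normalized vol (q V))) :
    Fibre57LowOnAC 𝔎 X 𝔖 lo k := by
  classical
  set χ₀ : GaugeField S.P k G → ℝ := chiB 𝔎.carrier.M₁ (rcolOf S 𝔎.carrier) (eps1Of S 𝔎.carrier) k (Hist.triv S.P (k + 1)) with hχ₀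
  set φ : GaugeField S.P k G → ℝ := (lo k).indicator (fun _ => (1 : ℝ)) with hφ
  set c : ℝ := -(towerOfAC 𝔎 X 𝔖).Ecst k - (towerOfAC 𝔎 X 𝔖).Rm k with hc
  have hφm : Measurable φ := measurable_const.indicator hlom
  have hφ0 : ∀ U, 0 ≤ φ U := fun U => Set.indicator_nonneg (fun _ _ => zero_le_one) U
  have hφ1 : ∀ U, φ U ≤ 1 := fun U => Set.indicator_le_self' (fun _ _ => zero_le_one) U
  have hφinv : GaugeInvariant φ := fun u U => by
    rw [hφ]
    by_cases hU' : U ∈ lo k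
    · rw [Set.indicator_of_mem hU', Set.indicator_of_mem ((hloinv u U).2 hU')]
    · rw [Set.indicator_of_notMem hU', Set.indicator_of_notMem (fun h => hU' ((hloinv u U).1 h))]
  have hχm : Measurable χ₀ := measurable_chiB _ _ _ k _
  have hχinv : GaugeInvariant χ₀ := fun u U => chiB_gaugeAct _ _ _ k _ u U
  -- the two integrands: `φ`-cut (the row's) and `χB`-cut (the pins')
  set ρφ : Density S.P k G := fun U => φ U *
    Real.exp (-((towerOfAC 𝔎 X 𝔖).mainT k (Hist.triv S.P k) U) + (towerOfAC 𝔎 X 𝔖).Pint k (Hist.triv S.P k) U + c) with hρφ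
  set ρχ : Density S.P k G := fun U => χ₀ U *
    Real.exp (-((towerOfAC 𝔎 X 𝔖).mainT k (Hist.triv S.P k) U) + (towerOfAC 𝔎 X 𝔖).Pint k (Hist.triv S.P k) U + c) with hρχ
  obtain ⟨hρφm, hρφb, hρφinv⟩ := trivIntegrand_props 𝔎 X 𝔖 k hU hPm cP hPb hinv φ hφm hφ0 hφ1 hφinv c
  obtain ⟨hρχm, hρχb, hρχinv⟩ := trivIntegrand_props 𝔎 X 𝔖 k hU hPm cP hPb hinv χ₀ hχm (fun U => chiB_nonneg _ _ _ k _ U)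
    (fun U => chiB_le_one _ _ _ k _ U) hχinv c
  have hint : (fun U : GaugeField S.P k G => φ U *
      Real.exp (-((towerOfAC 𝔎 X 𝔖).mainT k (Hist.triv S.P k) U) + (towerOfAC 𝔎 X 𝔖).Pint k (Hist.triv S.P k) U
        - (towerOfAC 𝔎 X 𝔖).Ecst k - (towerOfAC 𝔎 X 𝔖).Rm k)) = ρφ := by
    funext U; rw [hρφ]; dsimp only; congr 2; rw [hc]; ring
  -- the local chart identity AT THE `χB`-CUT integrand (supported in `O`)
  have hρχO : ∀ U, U ∉ O → ρχ U = 0 := fun U hU => by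
    have h0 : χ₀ U = 0 := by
      by_contra h
      exact hU (hO U h)
    rw [hρχ]; dsimp only; rw [h0, zero_mul]
  have hT := hchart ρχ _ hρχm hρχb hρχinv hρχO
  -- monotonicity of the transport: `χB·e^{…} ≤ 𝟙_{lo k}·e^{…}` pointwise (`hdom`, `χB ≤ 1`)
  have hleρ : ∀ U, ρχ U ≤ ρφ U := fun U => by
    rw [hρχ, hρφ]; dsimp only
    refine mul_le_mul_of_nonneg_right ?_ (Real.exp_pos _).le
    by_cases h0 : χ₀ U = 0
    · rw [h0]; exact hφ0 _
    · rw [hφ, Set.indicator_of_mem (hdom _ h0)]; exact chiB_le_one _ _ _ k _ _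
  have hmonoT : rnTransport (X.av k).avg ρχ ≤ᵐ[fieldMeasure S.P (k + 1) G] rnTransport (X.av k).avg ρφ :=
    Summit.QuantumFields.Balaban3D.Proofs.Transport48.rnTransport_mono_ae (X.av_ac k) hleρ
      (AveragingRT.integrable_of_abs_le hρχm _ hρχb) (AveragingRT.integrable_of_abs_le hρφm _ hρφb)
  have hg : 0 < S.gk k := gk_pos S k
  have hgk : (towerOfAC 𝔎 X 𝔖).g k = S.gk k := rfl
  unfold Fibre57LowOnAC
  rw [hint]
  refine Filter.EventuallyLE.trans ?_ (hT.symm.le.trans hmonoT)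
  filter_upwards with V
  set m₁ : ℝ := (towerOfAC 𝔎 X 𝔖).mainT (k + 1) (Hist.triv S.P (k + 1)) V with hm₁
  set Po : ℝ := (piecesAC 𝔎 X 𝔖 k).Pold (Hist.triv S.P (k + 1)) V with hPo
  by_cases hV : V ∈ lo (k + 1)
  · rw [Set.indicator_of_mem hV, one_mul, hσ, hdg, hgk, hstar, hZU V, hFl V]
    refine le_of_eq ?_
    -- the `χB`-cut integral in the pins' currency
    have hΨ : ∀ ω, J (V, ω) * ρχ (Φ (V, ω)) = Real.exp (-(q V ω)) * (Real.exp (-m₁ + Po + c) *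
        (J (V, ω) * χ₀ (Φ (V, ω)) * Real.exp (-((towerOfAC 𝔎 X 𝔖).mainT k (Hist.triv S.P k) (Φ (V, ω)) - m₁)
          + ((towerOfAC 𝔎 X 𝔖).Pint k (Hist.triv S.P k) (Φ (V, ω)) - Po) + q V ω))) := fun ω => by
      rw [hρχ]; dsimp only
      have e : Real.exp (-((towerOfAC 𝔎 X 𝔖).mainT k (Hist.triv S.P k) (Φ (V, ω))) + (towerOfAC 𝔎 X 𝔖).Pint k (Hist.triv S.P k) (Φ (V, ω)) + c)
          = Real.exp (-(q V ω)) * (Real.exp (-m₁ + Po + c) * Real.exp (-((towerOfAC 𝔎 X 𝔖).mainT k (Hist.triv S.P k) (Φ (V, ω)) - m₁)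
            + ((towerOfAC 𝔎 X 𝔖).Pint k (Hist.triv S.P k) (Φ (V, ω)) - Po) + q V ω)) := by
        rw [← Real.exp_add, ← Real.exp_add]; congr 1; ring
      rw [e]; ring
    simp_rw [hΨ]
    rw [integral_exp_neg_mul_eq (hqm V) (hZ V), integral_const_mul]
    conv_rhs => rw [← Real.exp_log (hZ V), ← Real.exp_log (hpos V hV), ← Real.exp_add, ← Real.exp_add, ← Real.exp_add]
    congr 1; rw [hc]; ring
  · rw [Set.indicator_of_notMem hV, zero_mul]
    exact mul_nonneg (Real.exp_pos _).le (integral_nonneg fun ω => mul_nonneg (hJ0 _)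
      (by rw [hρχ]; dsimp only; exact mul_nonneg (chiB_nonneg _ _ _ k _ _) (Real.exp_pos _).le))

end Chart

/-! ## The currency exchange: from the socket `hmap` of `…WeightedFibreFormula` (local form) to the rows' local `hchart` -/

section Socket

open scoped NNReal ENNReal

variable {R : Type} [MeasurableSpace R]

omit [RegularGaugeGroup G] in
/-- **LOCAL `hchart` FROM `hmap`.**  If `Ū = (X.av k).avg` has a local weighted fibre chart in the sense of
`WeightedFibreFormula.rnTransport_ae_eq_weightedFibreIntegral_local` (parameter space `(R, κ)`, `κ` a probability measure, chart `Φ` on `S`, weight `J`,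
region `O`), then the rows' local chart hypothesis holds with `vol := κ` and the weight `J′ := e^{−(ℓσ + d_g·log g_k)·N}·𝟙_S·J` — for ANY normalisation
constants `N ℓσ d_g` (print's prefactor `e^{(ℓσ + d_g log g_k)N}` is then restored in front of the integral). [cite: Balaban1985UV3, (13)–(18) pp.259–260] -/
theorem localChart_of_hmap (k : ℕ) (κ : Measure R) [IsProbabilityMeasure κ]
    (Φ : GaugeField S.P (k + 1) G × R → GaugeField S.P k G) (J : GaugeField S.P (k + 1) G × R → ℝ≥0)
    (hΦ : Measurable Φ) (hJ : Measurable J) {T : Set (GaugeField S.P (k + 1) G × R)} (hT : MeasurableSet T) {O : Set (GaugeField S.P k G)}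
    (hmap : ((((fieldMeasure S.P (k + 1) G).prod κ).restrict T).withDensity (fun z => (J z : ℝ≥0∞))).map Φ = (fieldMeasure S.P k G).restrict O)
    (hfib : ∀ z ∈ T, (X.av k).avg (Φ z) = z.1) (N lσ dg : ℝ)
    (ρ : Density S.P k G) (C : ℝ) (hρm : Measurable ρ) (hρb : ∀ U, |ρ U| ≤ C) (hρO : ∀ U, U ∉ O → ρ U = 0) :
    rnTransport (X.av k).avg ρ =ᵐ[fieldMeasure S.P (k + 1) G] fun V =>
      Real.exp ((lσ + dg * Real.log (S.gk k)) * N) *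
        ∫ r, (Real.exp (-((lσ + dg * Real.log (S.gk k)) * N)) * T.indicator (fun z => (J z : ℝ)) (V, r)) * ρ (Φ (V, r)) ∂κ := by
  have hρi : Integrable ρ (fieldMeasure S.P k G) := AveragingRT.integrable_of_abs_le hρm C hρb
  have h := WeightedFibreFormula.rnTransport_ae_eq_weightedFibreIntegral_local (X.av_ac k) hΦ hJ hT hmap hfib ρ hρi hρO
  refine h.trans (Filter.Eventually.of_forall fun V => ?_)
  have hpt : ∀ r, T.indicator (fun z => (J z : ℝ) * ρ (Φ z)) (V, r) =
      Real.exp (-((lσ + dg * Real.log (S.gk k)) * N)) * T.indicator (fun z => (J z : ℝ)) (V, r) * ρ (Φ (V, r)) *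
        Real.exp ((lσ + dg * Real.log (S.gk k)) * N) := fun r => by
    by_cases hz : (V, r) ∈ T
    · rw [Set.indicator_of_mem hz, Set.indicator_of_mem hz]
      have e : Real.exp (-((lσ + dg * Real.log (S.gk k)) * N)) * Real.exp ((lσ + dg * Real.log (S.gk k)) * N) = 1 := by
        rw [← Real.exp_add, neg_add_cancel, Real.exp_zero]
      calc (J (V, r) : ℝ) * ρ (Φ (V, r)) = (J (V, r) : ℝ) * ρ (Φ (V, r)) * (Real.exp (-((lσ + dg * Real.log (S.gk k)) * N)) *
            Real.exp ((lσ + dg * Real.log (S.gk k)) * N)) := by rw [e, mul_one]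
        _ = _ := by ring
    · rw [Set.indicator_of_notMem hz, Set.indicator_of_notMem hz]; ring
  simp_rw [hpt]
  rw [integral_mul_const, mul_comm]

end Socket

end Summit.QuantumFields.YangMills.Theorems.PinnedStepTrivPins

end
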